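import Literature.NumberTheory.EllipticCurves.CuspFormLFunction
import Literature.NumberTheory.EllipticCurves.AnalyticRank
import Literature.NumberTheory.DiophantineGeometry.Conductor
import HarnessLib

/-!
# `L(E,1) ≠ 0` for elliptic curves of PRIME conductor with a rational point of order `2`
# (Mazur's winding isomorphism at the `2`-Eisenstein prime, *Eisenstein ideal* II (18.10))

Topic `Literature/NumberTheory/EllipticCurves`; namespace `Literature.NumberTheory.EllipticCurves`.
ONE named fact (D-0014), no definition, no instance.

## The statements as printed (held text `paper:doi-10-1007-bf02684339`, B. Mazur, *Modular curves
## and the Eisenstein ideal*, Publ. Math. IHÉS 47 (1977) 33–186; PDF page `k` = journal page `k + 31`)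

Setting (II §9, p. 95–96). `N` prime, `𝕋` the Hecke algebra of `J = J₀(N)` generated by the `T_ℓ`
(`ℓ ≠ N`) and `w`; "The Eisenstein ideal `𝔍 ⊂ 𝕋` is the ideal generated by the elements `1 + ℓ − T_ℓ`
(all `ℓ ≠ N`) and by `1 + w`." **Prop. (9.7)**: "`𝕋/𝔍 ≅ ℤ/n`" with `n = num((N − 1)/12)`; "A prime ideal
`𝔓 ⊂ 𝕋` in the support of the Eisenstein ideal is called an Eisenstein prime. The Eisenstein primes are
in one-one correspondence with the prime numbers `p` which divide `n` … `𝔓 = (𝔍, p)` … `𝕋/𝔓 = 𝔽_p`."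
Winding element (II §18, p. 136–137): `H = H₁(X₀(N)(ℂ), ℤ)`, `U ≅ H ⊗ ℝ` the universal cover of
`J(ℂ)`, `h̃ : [0, i∞] → U` the lift of the fundamental arc with `h̃(i∞) = 0`; "**Definition.** Set
`e = h̃(0) ∈ U`. Call `e` the winding element." **Lemma (18.6)**: "`𝔍·e ⊂ H⁺ ⊂ U`. The winding
element `e` is in `H⁺ ⊗ ℚ`"; "`e₊ : 𝔍 → H⁺`, `a ↦ a·e` … We shall call the homomorphisms `e₋` and `e₊`
winding homomorphisms. The winding homomorphisms are (conveniently normalized) generalizations of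
the winding numbers of [Mazur–Swinnerton-Dyer, *Arithmetic of Weil curves*]."
**Theorem (18.10)** (p. 139, *Local principality of the Eisenstein ideal*): "Let `p` be a prime
number dividing `n`. Let `𝔓` be the associated Eisenstein prime. Let `ℓ` be a prime number different
from `N`. Then `η_ℓ` is a generator of the ideal `𝔍_𝔓 = 𝔍·𝕋_𝔓 ⊂ 𝕋_𝔓` if and only if `ℓ` is a good prime
number (with respect to `p`). **The winding homomorphism `e₊ : 𝔍_𝔓 → H⁺_𝔓 is an isomorphism of
`𝕋_𝔓`-modules.**" followed by "**Remark.** Except for the "only if" part of the theorem and the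
assertion concerning the winding homomorphism, the "new" information conveyed by (18.10) is for
`p = 2`."
Elliptic factors (III §7, p. 162–163): "we are reduced to the case `p = 2`. In this case, either
`N = 17` and `E` is isogenous to `X₀(17)`, or it is a Neumann–Setzer curve (which, by definition, is an
elliptic curve over `ℚ` of prime conductor `N ≠ 17` possessing a point of order `2` in its Mordell–Weil
group)"; **Prop. (7.4) (ii)**: "The `2`-Eisenstein quotient `J̃^{(2)}` has no elliptic curve factor unless
`N = 17`, or `N = 64 + u²` with `u` an integer. … If the (two) Neumann–Setzer curves of conductor `N`
are parametrized by modular functions for `Γ₀(N)` (i.e. if they occur as quotients of `J`, a special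
case of the conjecture of Weil) then they are quotients of `J̃`."

## The reading typed here

`Mazur1977_entireLFunction_one_ne_zero_of_prime_conductor_of_two_torsion`: for an elliptic curve
`W/ℚ` of PRIME conductor `N` whose `L`-function is that of a weight-`2` newform `f` on `Γ₀(N)` (the
tree's modularity glue `ModularForms.IsNewformOf W f`, i.e. "parametrized by modular functions for
`Γ₀(N)`" — now the theorem of Wiles / Taylor–Wiles / BCDT, kept as a HYPOTHESIS exactly as in
Prop. (7.4) (ii)) and which has a rational point of order `2`, `L(W, 1) ≠ 0`
(`W.entireLFunction 1 ≠ 0`, the tree's spelling of `L(E,1) ≠ 0` as in `kato_finite_of_L_one_ne_zero`).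
Derivation from the displayed statements (one paragraph, no input beyond [Mazur1977]):
(a) a rational point of order `2` gives `a_ℓ(f) = a_ℓ(W) ≡ 1 + ℓ (mod 2)` for every prime `ℓ ≠ N`
(`ℓ` odd: the point survives reduction, so `#W̃(𝔽_ℓ) = 1 + ℓ − a_ℓ` is even; `ℓ = 2 ≠ N`: a curve with
good reduction at `2` and a rational `2`-torsion point is ordinary at `2`, so `a₂` is odd), and
`1 + w ↦ 1 ± 1 ≡ 0 (mod 2)`; hence the eigencharacter `φ_f : 𝕋 → ℤ` of `f` maps `𝔍` into `2ℤ`, so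
`(𝔍, 2) ≠ 𝕋`, `2 ∣ n` (9.7), and the minimal prime `ker φ_f` lies in the `2`-Eisenstein prime
`𝔓 = (𝔍, 2)` — `f` "belongs to `J̃^{(2)}`" (this is the content of (7.4) (ii));
(b) by (18.10) and `[𝕋_𝔓 : 𝔍_𝔓] = #(ℤ_2/n) < ∞`, the winding element `e` generates the free rank-one
`𝕋_𝔓 ⊗ ℚ₂`-module `H⁺_𝔓 ⊗ ℚ₂ = ⊕_{(g,λ) ↦ 𝔓} H⁺_g ⊗_{K_g} K_{g,λ}`, so its component `e_f` in the
`f`-eigenline `H⁺_f ⊗ ℚ₂` is non-zero;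
(c) `e_f` is the functional `ω_f ↦ ∫_{i∞}^{0} ω_f`, i.e. `±L(f,1)/Ω` up to the non-zero period — the
"winding number" of [Mazur–Swinnerton-Dyer] — so `L(f, 1) ≠ 0`, and `L(W, s) = L(f, s)`.
Consequence recorded in print: "Neumann–Setzer curves have rank 0" [SteinWatkins2004, §4.3]; the
family is `X₀(17)` and the Neumann–Setzer pairs of conductor `N = u² + 64` prime
(`N = 73, 89, 113, 233, 353, …`).

## What is NOT here

* The general Eisenstein prime: for every `p ∣ n` and every newform `g` of level `N` congruent to the
  Eisenstein series modulo a prime above `p`, `L(g, 1) ≠ 0` (same proof). TODO(general form): needs the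
  tree's newform-congruence vocabulary; only the elliptic-curve case `p = 2` (the one with infinitely
  many members, conjecturally: `N = u² + 64` prime) is typed.
* Finiteness of `E(ℚ)` for such `E` (III (3.1): `J̃(ℚ) ≅ ℤ/n`), the `𝔓`-part of `Ш` (III (3.6), odd `p`
  only), and anything about the `2`-part of the Birch–Swinnerton-Dyer formula.
* Setzer's classification (`N = 17` or `N = u² + 64`): the tree's
  `Setzer1975_primeConductor_rationalTwoTorsion` (`NeumannSetzerCurves.lean`); not used here.

## References

* [Mazur1977] B. Mazur, *Modular curves and the Eisenstein ideal*, Publ. Math. IHÉS 47 (1977): II §9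
  (p. 95–96, Prop. 9.7), II §18 (p. 136–139: (18.6), Thm. (18.10) and Remark), III §7 (p. 162–163,
  Prop. 7.4 (ii)). Held: `paper:doi-10-1007-bf02684339`.
* [SteinWatkins2004] W. Stein, M. Watkins, *Modular parametrizations of Neumann–Setzer elliptic
  curves*, IMRN 2004:27, §2 (the `2`-Eisenstein prime `𝔪 = (2) + 𝔍`, `𝕋/𝔪 ≅ ℤ/2`), §4.3 ("since
  Neumann–Setzer curves have rank 0"). Held: `paper:arxiv-math_0404333`.
* [Merel1996] L. Merel, *Bornes pour la torsion des courbes elliptiques sur les corps de nombres*,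
  Invent. Math. 124 (1996) (the winding quotient `J_e`; not needed here).
-/

namespace Literature.NumberTheory.EllipticCurves

open ModularForms

/-- **Mazur 1977, II Thm. (18.10) read on elliptic curves (with III Prop. (7.4) (ii)): an elliptic
curve of PRIME conductor with a rational point of order `2` has `L(E, 1) ≠ 0`.**
For `W/ℚ` elliptic of prime conductor `N = W.conductorNorm ℤ`, modular in the sense that some
weight-`2` newform `f` on `Γ₀(N)` has `aₙ(f) = aₙ(W)` ("parametrized by modular functions for
`Γ₀(N)`", kept as a hypothesis as printed), and possessing a rational point `P ≠ O` with `2P = O`: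
the newform `f` lies in the `2`-Eisenstein component of the Hecke algebra of `J₀(N)` (`a_ℓ ≡ 1 + ℓ
(mod 2)` for all `ℓ ≠ N`, `1 + w ≡ 0 (mod 2)`), and the winding homomorphism
`e₊ : 𝔍_𝔓 → H⁺_𝔓` being an ISOMORPHISM of `𝕋_𝔓`-modules at the Eisenstein prime `𝔓 = (𝔍, 2)`
("the new information conveyed by (18.10) is for `p = 2`"), the `f`-component of the winding element
`e = ∫_{i∞}^{0}` is non-zero, i.e. `L(W, 1) = L(f, 1) ≠ 0`. Covers `X₀(17)` and every Neumann–Setzer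
curve (`N = u² + 64`). Spelling of `L(E,1) ≠ 0` as in `kato_finite_of_L_one_ne_zero`
(`W.entireLFunction 1 ≠ 0`). Named fact: the Hecke algebra `𝕋 ⊂ End J₀(N)`, its Eisenstein
completion and the winding element are not in the tree.
[cite: Mazur1977, II Thm. (18.10) and Remark (p. 139); II (18.6) (p. 136–137); II Prop. (9.7) (p. 96); III Prop. (7.4) (ii) (p. 163)] -/
def Mazur1977_entireLFunction_one_ne_zero_of_prime_conductor_of_two_torsion : Prop :=
  ∀ (W : WeierstrassCurve ℚ) [W.IsElliptic] [NeZero (W.conductorNorm ℤ)],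
    (W.conductorNorm ℤ).Prime →
    (∃ f : CuspForm (CongruenceSubgroup.Gamma0 (W.conductorNorm ℤ)) 2, IsNewformOf W f) →
    (∃ P : W.toAffine.Point, P ≠ 0 ∧ 2 • P = 0) →
    W.entireLFunction 1 ≠ 0

end Literature.NumberTheory.EllipticCurves
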